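import Literature.MathematicalPhysics.QuantumFieldTheory.Balaban1983to89.B9Thm312WholeClasses

/-!
# `Balaban1983to89.B9Thm312WholeHolder` — [B9] Theorem 3.12 (p. 423): the HÖLDER MEMBERS (3.43)–(3.45) of the Sect.-D propagators
# G, G₁ at one member and one configuration, as operator-level majorants from Theorem 3.3 for G₀ and the perturbation step in the
# Hölder classes (the theorems over the schemas of `…B9Thm312WholeClasses`)

T. Bałaban, *Propagators for lattice gauge theories in a background field*, Commun. Math. Phys. **99** (1985) 389–434
[`Balaban1985BackgroundPropagators`, "B9"]; [4] = T. Bałaban, *Propagators and renormalization transformations for lattice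
gauge theories. II*, Commun. Math. Phys. **96** (1984) 223–250 [`Balaban1984PropagatorsII`].

statement-level skeleton of published theorems with citation tags; proofs where landed; nothing here is a claim about the
Yang–Mills mass gap

THE PRINTED LOCI are those of `…B9Thm312WholeClasses` (verbatim there): (3.43)–(3.45) p. 398, Theorem 3.3 p. 399, (3.130) p. 421 and
the placement of the derivatives of Δ′_π (p. 421), p. 422 (*"convergence of the series (3.130) … in all norms appearing on the left-hand
sides of the inequalities (3.42)–(3.47)"*), p. 423 (the displayed Hölder pattern for (3.138)), p. 398 (the scale transfer remark).

WHAT THIS FILE PROVES (one member, one U; A ∈ {G, G₁} through A = G₀ + G₀TA — `B9Thm312WholeLeaf.fix_of_inverses` — and the RIGHT form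
A = G₀ + ATG₀ — `fix_right_of_inverses`, from the same one-sided identities since the lattice is finite; T = Δ′_π or Δ′_π + Δ⁽²⁾_π):
* `fix_right_of_inverses`, `comp_fix_rightEntry`, `comp_fix_twoSided_right` (algebra of (3.130)); `hasMaj_entry2_cNorm` (A∇\*_U : 𝔠_Y^{(0)} →
  𝔠^{(−1)} with decay, the state-norm form of `B9Thm312WholeLeaf.entry2_of_step`); `hasMaj_entry1_transfer` (∇_UA : 𝔠^{(1)} → 𝔠_Y^{(0)}
  after the scale transfer of p. 398);
* ★ `probe43L_cNormR` ∕ ★ `probe43L_of_step` — THE LEFT (3.43) MEMBER: Φ^Y_β∘∇_U∘A = Φ^Y_β∘∇_U∘G₀ + (Φ^Y_β∘∇_UG₀T)∘A, majorant (B_h(β) +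
  θ_H·B₀(1 − θc)⁻¹·c)·(Lʲη)^{1−β}·e^{−ρd};
* ★ `probe43R_of_step` — THE RIGHT (3.43) MEMBER: Φ^X_β∘(A∇\*) = Φ^X_β∘(G₀∇\*) + (Φ^X_β∘G₀T)∘(A∇\*), same constant;
* ★ `input44_of_step` — (3.44): ∇_UA∇\* = ∇_UG₀∇\* + (∇_UA)(TG₀∇\*), majorant (B_i(ε) + C₁Λ·θ_H·c)·e^{−ρ₂d} from `bH ε`, C₁ the (3.42)₂
  constant of `B9Thm312WholeLeft.entry1_of_stepD`, ρ₂ + σ ≦ (1 − α)ρ;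
* ★ `input45_of_step` — (3.45): Φ^Y_β∘∇_UA∇\* from `bH (β+ε)`, majorant (B_i(ε,β) + C_h(β)Λ·θ_H·c)·(Lʲη)^{−β}·e^{−ρ₂d};
— EXACTLY the inputs `hL`, `hRt`, `h44`, `h45` of n06-k's `B9RWSumsReadsRel.line343_of_hasMajorantHom_rel` ∕ `lines3445_of_hasMaj_rel`, for
G and G₁.  Each is one resolvent identity + one composition ([4] (2.54) + (2.61), `B11SectG.hasMaj_comp_exp`) + (for (3.44)–(3.45)) one
scale transfer ((2.60), `B9Thm312WholeClasses.hasMaj_transfer`).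

HONEST SCOPE.  Nothing of [B9] or [4] is asserted: Theorem 3.3 for G₀ in the Hölder classes, the step majorants, [4] Lemma 2.1 and the
scale transfer are HYPOTHESES of printed shape (arguments of the theorems); the content is the printed bookkeeping, kernel-checked.
NOT a node discharge, NOT summit progress; one finite lattice at a time; nothing continuum, nothing about the mass gap.  Cell
`pub-ymgap` (HUMAN RULING D-0062), Track A node N06 [B9], N06-ASSIGNMENT v1 rows 20–21 (bundle F7), seat `pub-ymgap-dag-n06-l` (g4),
2026-08-27.
-/

namespace Literature.MathematicalPhysics.QuantumFieldTheory.Balaban1983to89.B9Thm312WholeHolder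

open Literature.MathematicalPhysics.QuantumFieldTheory.Balaban1983to89
open Finset B6RandomWalk B6RandomWalkHom B9Thm34Ext B9Thm37GlueCor36 B11SectG B9SectDSup
open B9Thm37AllNorms B9Thm37AllNormsInstances B9Thm312Whole B9Thm312WholeLeaf B9Thm312WholeLeft B9RWSums343Holder
open B9Ineq347 B9Ineq347AllEntries B9Thm312WholeClasses

noncomputable section

/-! ## §3 One member, one U: the Hölder-class majorants of A ∈ {G, G₁} -/

section OneMember

variable {g : B9.Geometry} {B : B9.Backgrounds} {X Y PX PY : Type}
variable [Fintype X] [Fintype Y] [Fintype PX] [Fintype PY] [Fintype g.Site]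
variable {R₀ : ℝ} {H₀ : Prop}

/-- **(3.130) in the RIGHT fixed-point form A = G₀ + AΔ′G₀** from the same one-sided identities as `B9Thm312WholeLeaf.fix_of_inverses`
(G₀Δ_a = I, (Δ_a − Δ′)A = I): on the finite lattice one-sided inverses are two-sided (`mul_eq_one_comm`), so Δ_aG₀ = I and A(Δ_a − Δ′)
= I, whence AΔ′G₀ = A(Δ_a − (Δ_a − Δ′))G₀ = A − G₀ — the form in which every leading derivative of Δ′ lands on the G₀ to its right
(p. 421). [cite: Balaban1985BackgroundPropagators, (3.130) p.421 + p.421 (placement of the derivatives)] -/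
theorem fix_right_of_inverses {G0 S0 T A : Module.End ℝ (X → ℝ)} (h0 : G0 * S0 = 1) (h : (S0 - T) * A = 1) :
    A = G0 + A ∘ₗ T ∘ₗ G0 := by
  have h0' : S0 * G0 = 1 := mul_eq_one_comm.mp h0
  have h' : A * (S0 - T) = 1 := mul_eq_one_comm.mp h
  have h1 : A * T * G0 = A - G0 := by
    calc A * T * G0 = A * (S0 - (S0 - T)) * G0 := by rw [sub_sub_cancel]
      _ = A * S0 * G0 - A * (S0 - T) * G0 := by rw [mul_sub, sub_mul]
      _ = A - G0 := by rw [mul_assoc A S0 G0, h0', h', mul_one, one_mul]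
  have h2 : A ∘ₗ T ∘ₗ G0 = A * T * G0 := by rw [mul_assoc]; rfl
  rw [h2, h1, add_sub_cancel]

omit [Fintype X] in
/-- A = G₀ + G₀TA gives AF = G₀F + (G₀T)(AF) for every right factor F (the right-entry form, cf. `B9SectDL2Decay.rightEntry_fix`).
[cite: Balaban1985BackgroundPropagators, (3.130) p.421] -/
theorem comp_fix_rightEntry {V : Type} {G0 T A : Module.End ℝ (X → ℝ)} (Fop : (V → ℝ) →ₗ[ℝ] (X → ℝ))
    (hfix : A = G0 + G0 ∘ₗ T ∘ₗ A) : A ∘ₗ Fop = G0 ∘ₗ Fop + (G0 ∘ₗ T) ∘ₗ (A ∘ₗ Fop) := by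
  refine LinearMap.ext fun f => ?_
  have hpt : A (Fop f) = G0 (Fop f) + G0 (T (A (Fop f))) := by
    conv_lhs => rw [hfix]
    simp only [LinearMap.add_apply, LinearMap.comp_apply]
  simp only [LinearMap.comp_apply, LinearMap.add_apply]
  exact hpt

omit [Fintype X] in
/-- A = G₀ + ATG₀ gives E(AF) = E(G₀F) + (EA)(TG₀F) for every left factor E and right factor F (the two-sided right form).
[cite: Balaban1985BackgroundPropagators, (3.130) p.421] -/
theorem comp_fix_twoSided_right {V V' : Type} {G0 T A : Module.End ℝ (X → ℝ)} (Eop : (X → ℝ) →ₗ[ℝ] (V' → ℝ))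
    (Fop : (V → ℝ) →ₗ[ℝ] (X → ℝ)) (hfixR : A = G0 + A ∘ₗ T ∘ₗ G0) :
    Eop ∘ₗ (A ∘ₗ Fop) = Eop ∘ₗ (G0 ∘ₗ Fop) + (Eop ∘ₗ A) ∘ₗ (T ∘ₗ (G0 ∘ₗ Fop)) := by
  refine LinearMap.ext fun f => ?_
  have hpt : A (Fop f) = G0 (Fop f) + A (T (G0 (Fop f))) := by
    conv_lhs => rw [hfixR]
    simp only [LinearMap.add_apply, LinearMap.comp_apply]
  simp only [LinearMap.comp_apply, LinearMap.add_apply]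
  rw [hpt, map_add]

/-- The right entry A∇\*_U : 𝔠_Y^{(0)} → 𝔠^{(1)} with decay (the `HasMaj` form behind `B9Thm312WholeLeaf.entry2_of_step`): from (3.42)₃ for G₀,
the step on 𝔠^{(1)} and A = G₀ + G₀TA, A∇\* has majorant B₀(1 − θc)⁻¹e^{−ρd} from the sharp blocks of `Y` into `cNorm … 1`.
[cite: Balaban1985BackgroundPropagators, Thm 3.12 p.423 + (3.42) p.397 + (3.130) p.421] -/
theorem hasMaj_entry2_cNorm (hG : GeoOK g) {blk : X → g.Site} {blkY : Y → g.Site} {G0 T A : Module.End ℝ (X → ℝ)}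
    {Ds : (Y → ℝ) →ₗ[ℝ] (X → ℝ)} {θ B₀ δ₀ δK ρ σ c : ℝ} (hrow : RowSum (toB6 g R₀ H₀) σ c)
    (hθ : 0 ≤ θ) (hB₀ : 0 ≤ B₀) (hρ : 0 ≤ ρ) (hρS : ρ ≤ δ₀) (hρδ : ρ + σ ≤ δK)
    (hK : HasMaj (cNorm R₀ H₀ blk hG.lenle 1) (cNorm R₀ H₀ blk hG.lenle 1) (G0 ∘ₗ T)
      (fun a b => θ * Real.exp (-(δK * g.dist a b))))
    (he2 : HasMajorantHom (g := toB6 g R₀ H₀) blkY blk (G0 ∘ₗ Ds)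
      (fun a b => B₀ * g.len a * Real.exp (-(δ₀ * g.dist a b))))
    (hfix : A = G0 + G0 ∘ₗ T ∘ₗ A) (hq : θ * c < 1) :
    HasMaj (cNorm R₀ H₀ blkY hG.lenle 0) (cNorm R₀ H₀ blk hG.lenle 1) (A ∘ₗ Ds)
      (fun a b => B₀ * (1 - θ * c)⁻¹ * Real.exp (-(ρ * g.dist a b))) := by
  -- adapted from `B9Thm312WholeLeaf.entry2_of_step` (same seat), the majorant kept in the state norms
  have h0 : HasMaj (BlockNorm.ofBlocks (toB6 g R₀ H₀) blkY) (BlockNorm.ofBlocks (toB6 g R₀ H₀) blk) (G0 ∘ₗ Ds)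
      (fun a b => B₀ * g.len a * Real.exp (-(δ₀ * g.dist a b))) :=
    hasMaj_of_hasMajorantHom (G := toB6 g R₀ H₀) blkY blk
      (fun a b => mul_nonneg (mul_nonneg hB₀ (hG.lenle a)) (Real.exp_nonneg _)) he2
  have hS : HasMaj (cNorm R₀ H₀ blkY hG.lenle 0) (cNorm R₀ H₀ blk hG.lenle 1) (G0 ∘ₗ Ds)
      (fun a b => B₀ * Real.exp (-(δ₀ * g.dist a b))) := by
    refine (hasMaj_cNorm_of_hasMaj hG 1 0 h0).mono fun y y' => le_of_eq ?_
    have hy : g.len y ≠ 0 := (hG.lenpos y).ne'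
    simp only [wt, pow_zero, pow_one, mul_one]
    rw [mul_assoc B₀, mul_comm (g.len y), ← mul_assoc B₀, mul_assoc, mul_inv_cancel₀ hy, mul_one]
  exact hasMaj_right_of_step hG hrow hθ hB₀ hρ hρS hρδ hK hS hfix hq

/-- ★ **THEOREM 3.12, THE LEFT (3.43) MEMBER OF A ∈ {G, G₁}, WEIGHTED FORM**: Φ^Y_β∘∇_U∘A = Φ^Y_β∘∇_U∘G₀ + (Φ^Y_β∘∇_UG₀T)∘A from A = G₀ +
G₀TA; the first term is Theorem 3.3's (3.43)₁ for G₀ (`h43`), the second ONE composition ([4] (2.54) + (2.61)) of the probe step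
𝔠^{(−2)} → 𝔠_P^{(β−1)} (`hP`, θ_H e^{−δ_K d}) with the right entry A : 𝔠^{(0)} → 𝔠^{(−2)} (B₀(1 − θc)⁻¹e^{−ρd}, `B9Thm312WholeLeft.hasMaj_entry0_cNorm`):
Φ^Y_β∘∇_U∘A has majorant (B_h + θ_H·B₀(1 − θc)⁻¹·c)·e^{−ρd} from 𝔠^{(0)} into 𝔠_P^{(β−1)} (ρ ≦ δ₀, ρ + σ ≦ δ_K, θc < 1).
[cite: Balaban1985BackgroundPropagators, Thm 3.12 p.423 + (3.43) p.398 + (3.130) p.421 + p.422; Balaban1984PropagatorsII, Lemma 2.1 p.234] -/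
theorem probe43L_cNormR (hG : GeoOK g) {blk : X → g.Site} {blkP : PY → g.Site} {G0 T A : Module.End ℝ (X → ℝ)}
    {E : (X → ℝ) →ₗ[ℝ] (PY → ℝ)} {θ θH B₀ Bh β δ₀ δK ρ σ c : ℝ} (hrow : RowSum (toB6 g R₀ H₀) σ c)
    (hθ : 0 ≤ θ) (hθH : 0 ≤ θH) (hB₀ : 0 ≤ B₀) (hBh : 0 ≤ Bh) (hρ : 0 ≤ ρ) (hρS : ρ ≤ δ₀) (hρδ : ρ + σ ≤ δK)
    (hK : HasMaj (cNorm R₀ H₀ blk hG.lenle 2) (cNorm R₀ H₀ blk hG.lenle 2) (G0 ∘ₗ T)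
      (fun a b => θ * Real.exp (-(δK * g.dist a b))))
    (he0 : HasMajorant (g := toB6 g R₀ H₀) blk G0 (fun a b => B₀ * g.len a ^ 2 * Real.exp (-(δ₀ * g.dist a b))))
    (h43 : HasMajorantHom (g := toB6 g R₀ H₀) blk blkP (E ∘ₗ G0)
      (fun (a b : g.Site) => Bh * g.len a ^ (1 - β) * Real.exp (-(δ₀ * g.dist a b))))
    (hP : HasMaj (cNormR R₀ H₀ blk hG.lenle (-2)) (cNormR R₀ H₀ blkP hG.lenle (β - 1)) ((E ∘ₗ G0) ∘ₗ T)
      (fun a b => θH * Real.exp (-(δK * g.dist a b))))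
    (hfix : A = G0 + G0 ∘ₗ T ∘ₗ A) (hq : θ * c < 1) :
    HasMaj (cNormR R₀ H₀ blk hG.lenle 0) (cNormR R₀ H₀ blkP hG.lenle (β - 1)) (E ∘ₗ A)
      (fun a b => (Bh + θH * (B₀ * (1 - θ * c)⁻¹) * c) * Real.exp (-(ρ * g.dist a b))) := by
  have hq1 : 0 ≤ (1 - θ * c)⁻¹ := inv_nonneg.mpr (by linarith)
  have hA₁ : 0 ≤ B₀ * (1 - θ * c)⁻¹ := mul_nonneg hB₀ hq1
  have htri : Triangle254 (toB6 g R₀ H₀) := fun a b c => hG.tri a b c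
  -- the right entry A : 𝔠^{(0)} → 𝔠^{(−2)}
  have hGF : HasMaj (cNormR R₀ H₀ blk hG.lenle 0) (cNormR R₀ H₀ blk hG.lenle (-2)) A
      (fun a b => B₀ * (1 - θ * c)⁻¹ * Real.exp (-(ρ * g.dist a b))) := by
    have h := hasMaj_toR hG (hasMaj_entry0_cNorm hG hrow hθ hB₀ hρ hρS hρδ hK he0 hfix hq)
    simp only [Nat.cast_zero, neg_zero, Nat.cast_ofNat] at h
    exact h
  -- the head term: Theorem 3.3 (3.43) for G₀, into the weighted probe class
  have h1 : HasMaj (cNormR R₀ H₀ blk hG.lenle 0) (cNormR R₀ H₀ blkP hG.lenle (β - 1)) (E ∘ₗ G0)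
      (fun a b => Bh * Real.exp (-(δ₀ * g.dist a b))) := by
    have h := hasMaj_cNormR_of_hasMajorantHom hG (C := fun a b => Bh * Real.exp (-(δ₀ * g.dist a b)))
      (fun a b => mul_nonneg hBh (Real.exp_nonneg _)) (1 - β) 0
      (hasMajorantHom_mono (g := toB6 g R₀ H₀) blk blkP h43 fun a b => le_of_eq (by simp only [Real.rpow_zero, mul_one]; ring))
    have e : -(1 - β) = β - 1 := by ring
    rw [e] at h
    exact h
  -- a row-sum constant is non-negative as soon as there is a site (else everything is vacuous)
  have hc : 0 ≤ c ∨ IsEmpty g.Site := by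
    by_cases hne : Nonempty g.Site
    · exact Or.inl (hrow.nonneg hne.some)
    · exact Or.inr (not_nonempty_iff.mp hne)
  rcases hc with hc | hemp
  swap
  · intro y' μ hμ y
    exact (hemp.false y).elim
  -- the tail: (EG₀T)A, one composition at the rate ρ
  have h2 : HasMaj (cNormR R₀ H₀ blk hG.lenle 0) (cNormR R₀ H₀ blkP hG.lenle (β - 1)) (((E ∘ₗ G0) ∘ₗ T) ∘ₗ A)
      (fun a b => (cNormR R₀ H₀ blk hG.lenle (-2) (X := X)).κ * θH * (B₀ * (1 - θ * c)⁻¹) * c *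
        Real.exp (-(ρ * g.dist a b))) :=
    hasMaj_comp_exp htri hG.dnn hrow hθH hA₁ hρ le_rfl hρδ hP hGF
  simp only [cNormR_κ, one_mul] at h2
  have hsum := (h1.of_rate_le hG.dnn hBh hρS).add h2
  have hop : E ∘ₗ A = E ∘ₗ G0 + ((E ∘ₗ G0) ∘ₗ T) ∘ₗ A := by
    rw [comp_fix_left E hfix]
    exact LinearMap.ext fun _ => rfl
  rw [← hop] at hsum
  exact hsum.mono fun a b => le_of_eq (by simp only [toB6_dist]; ring)

omit [Fintype Y] [Fintype PX] in
/-- ★ **THEOREM 3.12, THE LEFT (3.43) MEMBER OF A ∈ {G, G₁}, PRINTED SHAPE**: ‖ζ∇_UAλ‖_β read through the probes — Φ^Y_β∘(∇_U∘A) has the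
two-space sup majorant (B_h(β) + θ_H·B₀(1 − θc)⁻¹·c)·(Lʲη)^{1−β}·e^{−ρd(y,y′)} (the input `hL` of n06-k's `line343_of_hasMajorantHom_rel`).
[cite: Balaban1985BackgroundPropagators, Thm 3.12 p.423 + (3.43) p.398 + (3.130) p.421 + p.422; Balaban1984PropagatorsII, Lemma 2.1 p.234] -/
theorem probe43L_of_step (hG : GeoOK g) {blk : X → g.Site} (𝔭 : HolderProbes g B X Y PX PY) {G0 T A : Module.End ℝ (X → ℝ)}
    {Dop : (X → ℝ) →ₗ[ℝ] (Y → ℝ)} {U : B.Cfg} {θ θH B₀ Bh β δ₀ δK ρ σ c : ℝ} (hrow : RowSum (toB6 g R₀ H₀) σ c)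
    (hθ : 0 ≤ θ) (hθH : 0 ≤ θH) (hB₀ : 0 ≤ B₀) (hBh : 0 ≤ Bh) (hρ : 0 ≤ ρ) (hρS : ρ ≤ δ₀) (hρδ : ρ + σ ≤ δK)
    (hK : HasMaj (cNorm R₀ H₀ blk hG.lenle 2) (cNorm R₀ H₀ blk hG.lenle 2) (G0 ∘ₗ T)
      (fun a b => θ * Real.exp (-(δK * g.dist a b))))
    (he0 : HasMajorant (g := toB6 g R₀ H₀) blk G0 (fun a b => B₀ * g.len a ^ 2 * Real.exp (-(δ₀ * g.dist a b))))
    (h43 : HasMajorantHom (g := toB6 g R₀ H₀) blk 𝔭.blkPY (𝔭.ΦY U β ∘ₗ (Dop ∘ₗ G0))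
      (fun (a b : g.Site) => Bh * g.len a ^ (1 - β) * Real.exp (-(δ₀ * g.dist a b))))
    (hP : HasMaj (cNormR R₀ H₀ blk hG.lenle (-2)) (cNormR R₀ H₀ 𝔭.blkPY hG.lenle (β - 1))
      ((𝔭.ΦY U β ∘ₗ Dop ∘ₗ G0) ∘ₗ T) (fun a b => θH * Real.exp (-(δK * g.dist a b))))
    (hfix : A = G0 + G0 ∘ₗ T ∘ₗ A) (hq : θ * c < 1) :
    HasMajorantHom (g := toB6 g R₀ H₀) blk 𝔭.blkPY (𝔭.ΦY U β ∘ₗ (Dop ∘ₗ A))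
      (fun (a b : g.Site) => (Bh + θH * (B₀ * (1 - θ * c)⁻¹) * c) * g.len a ^ (1 - β) * Real.exp (-(ρ * g.dist a b))) := by
  have hq1 : 0 ≤ (1 - θ * c)⁻¹ := inv_nonneg.mpr (by linarith)
  have hc : 0 ≤ c ∨ IsEmpty g.Site := by
    by_cases hne : Nonempty g.Site
    · exact Or.inl (hrow.nonneg hne.some)
    · exact Or.inr (not_nonempty_iff.mp hne)
  rcases hc with hc | hemp
  swap
  · intro y' μ B' hμ p
    exact (IsEmpty.false (𝔭.blkPY p)).elim
  have hC0 : 0 ≤ Bh + θH * (B₀ * (1 - θ * c)⁻¹) * c := add_nonneg hBh (mul_nonneg (mul_nonneg hθH (mul_nonneg hB₀ hq1)) hc)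
  have h43' : HasMajorantHom (g := toB6 g R₀ H₀) blk 𝔭.blkPY ((𝔭.ΦY U β ∘ₗ Dop) ∘ₗ G0)
      (fun (a b : g.Site) => Bh * g.len a ^ (1 - β) * Real.exp (-(δ₀ * g.dist a b))) := h43
  have h := probe43L_cNormR hG hrow hθ hθH hB₀ hBh hρ hρS hρδ hK he0 h43' hP hfix hq
  have h' := hasMajorantHom_of_hasMaj_cNormR hG (fun a b => mul_nonneg hC0 (Real.exp_nonneg _)) h
  refine hasMajorantHom_mono (g := toB6 g R₀ H₀) blk 𝔭.blkPY h' fun a b => le_of_eq ?_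
  simp only [Real.rpow_zero, mul_one, show -(β - 1) = 1 - β by ring]
  ring

omit [Fintype PY] in
/-- ★ **THEOREM 3.12, THE RIGHT (3.43) MEMBER OF A ∈ {G, G₁}, PRINTED SHAPE**: A∇\* = G₀∇\* + (G₀T)(A∇\*) from A = G₀ + G₀TA; the first term is
Theorem 3.3's (3.43)₂ for G₀ (`h43`), the second ONE composition of the probe step 𝔠^{(−1)} → 𝔠_P^{(β−1)} (`hP`, the probe of G₀T) with
the right entry A∇\* : 𝔠_Y^{(0)} → 𝔠^{(−1)} (`hasMaj_entry2_cNorm`): Φ^X_β∘(A∘∇\*_U) has the two-space sup majorant (B_h(β) + θ_H·B₀(1 −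
θc)⁻¹·c)·(Lʲη)^{1−β}·e^{−ρd(y,y′)} (the input `hRt` of n06-k's `line343_of_hasMajorantHom_rel`).
[cite: Balaban1985BackgroundPropagators, Thm 3.12 p.423 + (3.43) p.398 + (3.130) p.421 + p.422; Balaban1984PropagatorsII, Lemma 2.1 p.234] -/
theorem probe43R_of_step (hG : GeoOK g) {blk : X → g.Site} {blkY : Y → g.Site} (𝔭 : HolderProbes g B X Y PX PY)
    {G0 T A : Module.End ℝ (X → ℝ)} {Ds : (Y → ℝ) →ₗ[ℝ] (X → ℝ)} {U : B.Cfg} {θ θH B₀ Bh β δ₀ δK ρ σ c : ℝ}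
    (hrow : RowSum (toB6 g R₀ H₀) σ c)
    (hθ : 0 ≤ θ) (hθH : 0 ≤ θH) (hB₀ : 0 ≤ B₀) (hBh : 0 ≤ Bh) (hρ : 0 ≤ ρ) (hρS : ρ ≤ δ₀) (hρδ : ρ + σ ≤ δK)
    (hK : HasMaj (cNorm R₀ H₀ blk hG.lenle 1) (cNorm R₀ H₀ blk hG.lenle 1) (G0 ∘ₗ T)
      (fun a b => θ * Real.exp (-(δK * g.dist a b))))
    (he2 : HasMajorantHom (g := toB6 g R₀ H₀) blkY blk (G0 ∘ₗ Ds)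
      (fun a b => B₀ * g.len a * Real.exp (-(δ₀ * g.dist a b))))
    (h43 : HasMajorantHom (g := toB6 g R₀ H₀) blkY 𝔭.blkPX (𝔭.ΦX U β ∘ₗ (G0 ∘ₗ Ds))
      (fun (a b : g.Site) => Bh * g.len a ^ (1 - β) * Real.exp (-(δ₀ * g.dist a b))))
    (hP : HasMaj (cNormR R₀ H₀ blk hG.lenle (-1)) (cNormR R₀ H₀ 𝔭.blkPX hG.lenle (β - 1))
      ((𝔭.ΦX U β ∘ₗ G0) ∘ₗ T) (fun a b => θH * Real.exp (-(δK * g.dist a b))))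
    (hfix : A = G0 + G0 ∘ₗ T ∘ₗ A) (hq : θ * c < 1) :
    HasMajorantHom (g := toB6 g R₀ H₀) blkY 𝔭.blkPX (𝔭.ΦX U β ∘ₗ (A ∘ₗ Ds))
      (fun (a b : g.Site) => (Bh + θH * (B₀ * (1 - θ * c)⁻¹) * c) * g.len a ^ (1 - β) * Real.exp (-(ρ * g.dist a b))) := by
  have hq1 : 0 ≤ (1 - θ * c)⁻¹ := inv_nonneg.mpr (by linarith)
  have hA₁ : 0 ≤ B₀ * (1 - θ * c)⁻¹ := mul_nonneg hB₀ hq1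
  have htri : Triangle254 (toB6 g R₀ H₀) := fun a b c => hG.tri a b c
  have hc : 0 ≤ c ∨ IsEmpty g.Site := by
    by_cases hne : Nonempty g.Site
    · exact Or.inl (hrow.nonneg hne.some)
    · exact Or.inr (not_nonempty_iff.mp hne)
  rcases hc with hc | hemp
  swap
  · intro y' μ B' hμ p
    exact (IsEmpty.false (𝔭.blkPX p)).elim
  have hC0 : 0 ≤ Bh + θH * (B₀ * (1 - θ * c)⁻¹) * c := add_nonneg hBh (mul_nonneg (mul_nonneg hθH hA₁) hc)
  -- the right entry A∇* : 𝔠_Y^{(0)} → 𝔠^{(−1)}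
  have hGF : HasMaj (cNormR R₀ H₀ blkY hG.lenle 0) (cNormR R₀ H₀ blk hG.lenle (-1)) (A ∘ₗ Ds)
      (fun a b => B₀ * (1 - θ * c)⁻¹ * Real.exp (-(ρ * g.dist a b))) := by
    have h := hasMaj_toR hG (hasMaj_entry2_cNorm hG hrow hθ hB₀ hρ hρS hρδ hK he2 hfix hq)
    simp only [Nat.cast_zero, neg_zero, Nat.cast_one] at h
    exact h
  -- the head term: Theorem 3.3 (3.43)₂ for G₀
  have h1 : HasMaj (cNormR R₀ H₀ blkY hG.lenle 0) (cNormR R₀ H₀ 𝔭.blkPX hG.lenle (β - 1)) (𝔭.ΦX U β ∘ₗ (G0 ∘ₗ Ds))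
      (fun a b => Bh * Real.exp (-(δ₀ * g.dist a b))) := by
    have h := hasMaj_cNormR_of_hasMajorantHom hG (C := fun a b => Bh * Real.exp (-(δ₀ * g.dist a b)))
      (fun a b => mul_nonneg hBh (Real.exp_nonneg _)) (1 - β) 0
      (hasMajorantHom_mono (g := toB6 g R₀ H₀) blkY 𝔭.blkPX h43 fun a b => le_of_eq (by simp only [Real.rpow_zero, mul_one]; ring))
    have e : -(1 - β) = β - 1 := by ring
    rw [e] at h
    exact h
  -- the tail: (Φ G₀T)(A∇*), one composition at the rate ρ
  have h2 : HasMaj (cNormR R₀ H₀ blkY hG.lenle 0) (cNormR R₀ H₀ 𝔭.blkPX hG.lenle (β - 1)) (((𝔭.ΦX U β ∘ₗ G0) ∘ₗ T) ∘ₗ (A ∘ₗ Ds))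
      (fun a b => (cNormR R₀ H₀ blk hG.lenle (-1) (X := X)).κ * θH * (B₀ * (1 - θ * c)⁻¹) * c *
        Real.exp (-(ρ * g.dist a b))) :=
    hasMaj_comp_exp htri hG.dnn hrow hθH hA₁ hρ le_rfl hρδ hP hGF
  simp only [cNormR_κ, one_mul] at h2
  have hsum := (h1.of_rate_le hG.dnn hBh hρS).add h2
  have hop : 𝔭.ΦX U β ∘ₗ (A ∘ₗ Ds) = 𝔭.ΦX U β ∘ₗ (G0 ∘ₗ Ds) + ((𝔭.ΦX U β ∘ₗ G0) ∘ₗ T) ∘ₗ (A ∘ₗ Ds) := by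
    conv_lhs => rw [comp_fix_rightEntry Ds hfix]
    rw [LinearMap.comp_add]
    exact LinearMap.ext fun _ => rfl
  rw [← hop] at hsum
  have h3 : HasMaj (cNormR R₀ H₀ blkY hG.lenle 0) (cNormR R₀ H₀ 𝔭.blkPX hG.lenle (β - 1)) (𝔭.ΦX U β ∘ₗ (A ∘ₗ Ds))
      (fun a b => (Bh + θH * (B₀ * (1 - θ * c)⁻¹) * c) * Real.exp (-(ρ * g.dist a b))) :=
    hsum.mono fun a b => le_of_eq (by simp only [toB6_dist]; ring)
  have h' := hasMajorantHom_of_hasMaj_cNormR hG (fun a b => mul_nonneg hC0 (Real.exp_nonneg _)) h3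
  refine hasMajorantHom_mono (g := toB6 g R₀ H₀) blkY 𝔭.blkPX h' fun a b => le_of_eq ?_
  simp only [Real.rpow_zero, mul_one, show -(β - 1) = 1 - β by ring]
  ring

/-- The left entry ∇_UA : 𝔠^{(1)} → 𝔠_Y^{(0)} after the scale transfer: from the (3.42)₂ majorant C₁Lʲη·e^{−ρd} of ∇_UA
(`B9Thm312WholeLeft.entry1_of_stepD`) and the transfer of the factor Lʲη∕L^{j′}η ((2.60) at (ρ, α), constant Λ), ∇_UA has majorant
C₁Λe^{−(1−α)ρd} from 𝔠^{(1)} into 𝔠_Y^{(0)}. [cite: Balaban1985BackgroundPropagators, (3.42) p.397 + p.398 (remark after (3.47)); Balaban1984PropagatorsII, (2.60) p.234] -/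
theorem hasMaj_entry1_transfer (hG : GeoOK g) {blk : X → g.Site} {blkY : Y → g.Site} {DA : (X → ℝ) →ₗ[ℝ] (Y → ℝ)}
    {C₁ ρ α Λ : ℝ} (hC₁ : 0 ≤ C₁) (hST : ScaleTransfer g ρ α Λ (fun y => g.len y ^ (1 : ℝ)))
    (h1 : HasMajorantHom (g := toB6 g R₀ H₀) blk blkY DA (fun a b => C₁ * g.len a * Real.exp (-(ρ * g.dist a b)))) :
    HasMaj (cNormR R₀ H₀ blk hG.lenle 1) (cNormR R₀ H₀ blkY hG.lenle 0) DA
      (fun a b => C₁ * Λ * Real.exp (-((1 - α) * ρ * g.dist a b))) := by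
  have h := hasMaj_cNormR_of_hasMajorantHom hG (C := fun a b => C₁ * Real.exp (-(ρ * g.dist a b)))
    (fun a b => mul_nonneg hC₁ (Real.exp_nonneg _)) 1 0
    (hasMajorantHom_mono (g := toB6 g R₀ H₀) blk blkY h1 fun a b => le_of_eq (by simp only [Real.rpow_zero, Real.rpow_one, mul_one]; ring))
  have ht := hasMaj_transfer hG hC₁ hST h
  have e1 : (0 : ℝ) + 1 = 1 := by ring
  have e2 : (-1 : ℝ) + 1 = 0 := by ring
  rw [e1, e2] at ht
  exact ht

/-- ★ **THEOREM 3.12, THE (3.44) MEMBER OF A ∈ {G, G₁}, PRINTED SHAPE**: ∇_UA∇\*_U = ∇_UG₀∇\*_U + (∇_UA)(TG₀∇\*_U) from the right form A = G₀ +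
ATG₀; the first term is Theorem 3.3's (3.44) for G₀ (`h44`), the second ONE composition of the left entry ∇_UA : 𝔠^{(1)} → 𝔠_Y^{(0)}
(`hasMaj_entry1_transfer`, C₁Λe^{−(1−α)ρd}) with the step TG₀∇\* from the input class (`htD`, θ_H e^{−δ_K d}): ∇_UA∇\*_U read from `bH ε`
into the sharp blocks of `Y` has majorant (B_i + C₁Λ·θ_H·c)·e^{−ρ₂d} for ρ₂ + σ ≦ (1 − α)ρ, ρ₂ ≦ δ_K, ρ₂ ≦ δ₀ (the input `h44` of
n06-k's `lines3445_of_hasMaj_rel`). [cite: Balaban1985BackgroundPropagators, Thm 3.12 p.423 + (3.44) p.398 + (3.130) p.421 + p.422; Balaban1984PropagatorsII, Lemma 2.1 p.234] -/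
theorem input44_of_step (hG : GeoOK g) {blk : X → g.Site} {blkY : Y → g.Site} {bHε : BlockNorm (toB6 g R₀ H₀) (Y → ℝ)}
    {G0 T A : Module.End ℝ (X → ℝ)} {Dop : (X → ℝ) →ₗ[ℝ] (Y → ℝ)} {Ds : (Y → ℝ) →ₗ[ℝ] (X → ℝ)}
    {θH Bi C₁ δ₀ δK ρ ρ₂ α Λ σ c : ℝ} (hrow : RowSum (toB6 g R₀ H₀) σ c)
    (hθH : 0 ≤ θH) (hBi : 0 ≤ Bi) (hC₁ : 0 ≤ C₁) (hΛ : 0 ≤ Λ) (hρ₂ : 0 ≤ ρ₂) (hρ₂σ : ρ₂ + σ ≤ (1 - α) * ρ)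
    (hρ₂K : ρ₂ ≤ δK) (hρ₂δ : ρ₂ ≤ δ₀) (hST : ScaleTransfer g ρ α Λ (fun y => g.len y ^ (1 : ℝ)))
    (h1 : HasMajorantHom (g := toB6 g R₀ H₀) blk blkY (Dop ∘ₗ A) (fun a b => C₁ * g.len a * Real.exp (-(ρ * g.dist a b))))
    (h44 : HasMaj bHε (BlockNorm.ofBlocks (toB6 g R₀ H₀) blkY) (Dop ∘ₗ (G0 ∘ₗ Ds))
      (fun (a b : g.Site) => Bi * Real.exp (-(δ₀ * g.dist a b))))
    (htD : HasMaj bHε (cNormR R₀ H₀ blk hG.lenle 1) (T ∘ₗ (G0 ∘ₗ Ds)) (fun a b => θH * Real.exp (-(δK * g.dist a b))))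
    (hfixR : A = G0 + A ∘ₗ T ∘ₗ G0) :
    HasMaj bHε (BlockNorm.ofBlocks (toB6 g R₀ H₀) blkY) (Dop ∘ₗ (A ∘ₗ Ds))
      (fun (a b : g.Site) => (Bi + C₁ * Λ * θH * c) * Real.exp (-(ρ₂ * g.dist a b))) := by
  have htri : Triangle254 (toB6 g R₀ H₀) := fun a b c => hG.tri a b c
  have hc : 0 ≤ c ∨ IsEmpty g.Site := by
    by_cases hne : Nonempty g.Site
    · exact Or.inl (hrow.nonneg hne.some)
    · exact Or.inr (not_nonempty_iff.mp hne)
  rcases hc with hc | hemp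
  swap
  · intro y' μ hμ y
    exact (hemp.false y).elim
  have hE := hasMaj_entry1_transfer hG hC₁ hST h1
  -- (∇A)(TG₀∇*) : bH ε → 𝔠_Y^{(0)}, one composition at the rate ρ₂
  have h2 : HasMaj bHε (cNormR R₀ H₀ blkY hG.lenle 0) ((Dop ∘ₗ A) ∘ₗ (T ∘ₗ (G0 ∘ₗ Ds)))
      (fun a b => (cNormR R₀ H₀ blk hG.lenle 1 (X := X)).κ * (C₁ * Λ) * θH * c * Real.exp (-(ρ₂ * g.dist a b))) :=
    hasMaj_comp_exp htri hG.dnn hrow (mul_nonneg hC₁ hΛ) hθH hρ₂ hρ₂K hρ₂σ hE htD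
  simp only [cNormR_κ, one_mul] at h2
  have hsum := (h44.of_rate_le hG.dnn hBi hρ₂δ).add (hasMaj_of_out_zero h2)
  rw [← comp_fix_twoSided_right Dop Ds hfixR] at hsum
  exact hsum.mono fun a b => le_of_eq (by simp only [toB6_dist]; ring)

omit [Fintype Y] in
/-- ★ **THEOREM 3.12, THE (3.45) MEMBER OF A ∈ {G, G₁}, PRINTED SHAPE**: Φ^Y_β∘∇_UA∇\*_U = Φ^Y_β∘∇_UG₀∇\*_U + (Φ^Y_β∘∇_UA)(TG₀∇\*_U) from the
right form; the first term is Theorem 3.3's (3.45) for G₀ (`h45`, weight (Lʲη)^{−β} on the probes), the second ONE composition of the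
proved left (3.43) member in its weighted form (`h43A` : 𝔠^{(0)} → 𝔠_P^{(β−1)}, transferred by (2.60) to 𝔠^{(1)} → 𝔠_P^{(β)}) with the step
TG₀∇\* from the input class `bH (β+ε)` (`htD`): Φ^Y_β∘∇_UA∇\*_U read from `bH (β+ε)` into the probe blocks has majorant (B_i2 +
C_hΛ·θ_H·c)·(Lʲη)^{−β}·e^{−ρ₂d} (the input `h45` of n06-k's `lines3445_of_hasMaj_rel`).
[cite: Balaban1985BackgroundPropagators, Thm 3.12 p.423 + (3.45) p.398 + (3.130) p.421 + p.423; Balaban1984PropagatorsII, Lemma 2.1 p.234] -/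
theorem input45_of_step (hG : GeoOK g) {blk : X → g.Site} {blkP : PY → g.Site} {bHε : BlockNorm (toB6 g R₀ H₀) (Y → ℝ)}
    {G0 T A : Module.End ℝ (X → ℝ)} {E : (X → ℝ) →ₗ[ℝ] (PY → ℝ)} {Ds : (Y → ℝ) →ₗ[ℝ] (X → ℝ)}
    {θH Bi2 Ch β δ₀ δK ρ ρ₂ α Λ σ c : ℝ} (hrow : RowSum (toB6 g R₀ H₀) σ c)
    (hθH : 0 ≤ θH) (hBi2 : 0 ≤ Bi2) (hCh : 0 ≤ Ch) (hΛ : 0 ≤ Λ) (hρ₂ : 0 ≤ ρ₂) (hρ₂σ : ρ₂ + σ ≤ (1 - α) * ρ)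
    (hρ₂K : ρ₂ ≤ δK) (hρ₂δ : ρ₂ ≤ δ₀) (hST : ScaleTransfer g ρ α Λ (fun y => g.len y ^ (1 : ℝ)))
    (h43A : HasMaj (cNormR R₀ H₀ blk hG.lenle 0) (cNormR R₀ H₀ blkP hG.lenle (β - 1)) (E ∘ₗ A)
      (fun a b => Ch * Real.exp (-(ρ * g.dist a b))))
    (h45 : HasMaj bHε (BlockNorm.ofBlocks (toB6 g R₀ H₀) blkP) (E ∘ₗ (G0 ∘ₗ Ds))
      (fun (a b : g.Site) => Bi2 * g.len a ^ (-β) * Real.exp (-(δ₀ * g.dist a b))))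
    (htD : HasMaj bHε (cNormR R₀ H₀ blk hG.lenle 1) (T ∘ₗ (G0 ∘ₗ Ds)) (fun a b => θH * Real.exp (-(δK * g.dist a b))))
    (hfixR : A = G0 + A ∘ₗ T ∘ₗ G0) :
    HasMaj bHε (BlockNorm.ofBlocks (toB6 g R₀ H₀) blkP) (E ∘ₗ (A ∘ₗ Ds))
      (fun (a b : g.Site) => (Bi2 + Ch * Λ * θH * c) * g.len a ^ (-β) * Real.exp (-(ρ₂ * g.dist a b))) := by
  have htri : Triangle254 (toB6 g R₀ H₀) := fun a b c => hG.tri a b c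
  have hc : 0 ≤ c ∨ IsEmpty g.Site := by
    by_cases hne : Nonempty g.Site
    · exact Or.inl (hrow.nonneg hne.some)
    · exact Or.inr (not_nonempty_iff.mp hne)
  rcases hc with hc | hemp
  swap
  · intro y' μ hμ y
    exact (hemp.false y).elim
  -- the left (3.43) member transferred: EA : 𝔠^{(1)} → 𝔠_P^{(β)}
  have hE : HasMaj (cNormR R₀ H₀ blk hG.lenle 1) (cNormR R₀ H₀ blkP hG.lenle β) (E ∘ₗ A)
      (fun a b => Ch * Λ * Real.exp (-((1 - α) * ρ * g.dist a b))) := by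
    have ht := hasMaj_transfer hG hCh hST h43A
    have e1 : (0 : ℝ) + 1 = 1 := by ring
    have e2 : β - 1 + 1 = β := by ring
    rw [e1, e2] at ht
    exact ht
  -- (EA)(TG₀∇*) : bH (β+ε) → 𝔠_P^{(β)}, one composition at the rate ρ₂
  have h2 : HasMaj bHε (cNormR R₀ H₀ blkP hG.lenle β) ((E ∘ₗ A) ∘ₗ (T ∘ₗ (G0 ∘ₗ Ds)))
      (fun a b => (cNormR R₀ H₀ blk hG.lenle 1 (X := X)).κ * (Ch * Λ) * θH * c * Real.exp (-(ρ₂ * g.dist a b))) :=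
    hasMaj_comp_exp htri hG.dnn hrow (mul_nonneg hCh hΛ) hθH hρ₂ hρ₂K hρ₂σ hE htD
  simp only [cNormR_κ, one_mul] at h2
  -- the head term, output-weighted, at the rate ρ₂
  have h1 : HasMaj bHε (cNormR R₀ H₀ blkP hG.lenle β) (E ∘ₗ (G0 ∘ₗ Ds)) (fun a b => Bi2 * Real.exp (-(ρ₂ * g.dist a b))) := by
    refine (hasMaj_weight_out hG (K := fun a b => Bi2 * Real.exp (-(δ₀ * g.dist a b))) ?_).of_rate_le hG.dnn hBi2 hρ₂δ
    exact h45.mono fun a b => le_of_eq (by ring)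
  have hsum := h1.add h2
  rw [← comp_fix_twoSided_right E Ds hfixR] at hsum
  have h3 : HasMaj bHε (cNormR R₀ H₀ blkP hG.lenle β) (E ∘ₗ (A ∘ₗ Ds))
      (fun a b => (Bi2 + Ch * Λ * θH * c) * Real.exp (-(ρ₂ * g.dist a b))) :=
    hsum.mono fun a b => le_of_eq (by ring)
  exact (hasMaj_unweight_out hG h3).mono fun a b => le_of_eq (by ring)

end OneMember

end

end Literature.MathematicalPhysics.QuantumFieldTheory.Balaban1983to89.B9Thm312WholeHolder
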